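import Summits.FinalStateConjecture.FinalStateConjecture.Theorems.HonestFixedRadiusSettlingT.Negative.KillShapeT
import HarnessLib

/-!
# `HonestFixedRadiusSettlingT` (crux stmt-FinalStateConjecture-17575): the OPEN-BASIN kill shape

Negative-side support file (line lead c7, cycle 8, 2026-08-17), `sorry`-free, no named facts, no definitions.
`T = Theses.StarvedNecks.HonestFixedRadiusSettlingT` is TAME Christodoulou genericity (codimension `1`) of
`P_T = (· ∈ settlingSetT Σ)` in the admissible class (`Negative.T_iff`, `Iff.rfl`).  `Negative.not_T_iff_exists_trapped`
(p135032) gives the exact shape of a refutation: a TRAPPED exceptional admissible datum.  A tame witness family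
`F` through `d` lives on ONE asymptotically flat end `e` and is `wDist`-continuous there at `c = 0`
(`IsTameDataFamily`, last conjunct), so the canonical trap is an OPEN BASIN: a `P_T`-exceptional admissible
datum `d` such that, on every end `e` of `Σ`, all admissible data within some positive weighted
Dafermos–Rodnianski distance `e.wDist · d < δ` of `d` are exceptional too.  This file types that interface once:

* `not_isTameChristodoulouGeneric_of_wDist_nhds` — the general lemma (any admissible class, any property, any
  codimension `m ≠ 0`): a `wDist`-neighbourhood of exceptional data on every end kills tame genericity;
* `not_T_of_wDist_nhds` — specialised to `T`;
* `T_false_of_wDist_nhds_hiddenRays` — the typed form of the refuter's liability L2 / BN-4-4 ("hidden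
  expanding region behind a neck on a one-ended `Σ = M # ℝ³`"): an admissible datum around which, `wDist`-openly
  on every end, every MGHD misses, for EVERY candidate `C⁴` decomposition `dd` of its self-determined exterior
  `O = exteriorOf 𝒟 dd.charted`, some future-complete normalised null ray from `Σ` (`¬ RaysStayInClosure`) —
  refutes `T`;
* `T_false_of_wDist_nhds_incompleteScri` — likewise an open basin of admissible data all of whose MGHDs have
  INCOMPLETE future null infinity (a stable naked singularity) refutes `T` (and, by the same shape, item 17269).

No such basin is known (Christodoulou 1999: naked singularities are expected to be unstable; the
Rodnianski–Shlapentokh-Rothman vacuum examples are non-generic by construction); the lemmas only fix what a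
counterexample has to deliver.  References: Christodoulou, CQG 16 (1999) A23, p. A24 (genericity by positive
codimension; lines `α₀ + c f` in a fixed space of data with fixed asymptotics); Dafermos–Rodnianski
arXiv:0811.0354, App. B.2.3 (the weighted norms); Dafermos–Luk arXiv:1710.01722, Conjecture 1.
-/

-- every `Summit.FinalStateConjecture.FinalStateConjecture.…` name repeats the summit = sub-problem segment (D-0017 layout)
set_option linter.dupNamespace false

noncomputable section

open Literature.Geometry.Lorentzian
open scoped Manifold ContDiff ENNReal Topology
open Filter Set TopologicalSpace Function

namespace Summit.FinalStateConjecture.FinalStateConjecture.Theorems.HonestFixedRadiusSettlingT.Negative.OpenBasin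

open Summit.FinalStateConjecture.FinalStateConjecture.Theses.StarvedNecks
open Summit.FinalStateConjecture (HasCompleteNullInfinity exteriorOf RaysStayInClosure)
open Literature.Geometry.Lorentzian.InitialDataSet
  (IsTameDataFamily IsImmersedAtZero IsTameChristodoulouGeneric HasTameCodimAtLeastIn)

variable {X : Type} [TopologicalSpace X] [ChartedSpace E3 X] [IsManifold (𝓡 3) ∞ X]

/-- **A `wDist`-neighbourhood of exceptional data kills tame genericity** (any admissible class `𝓓`, any
property `P`, any codimension `m ≠ 0`).  If `d ∈ 𝓓` fails `P` and, on EVERY asymptotically flat end `e` of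
`X`, all data of `𝓓` within some positive weighted distance `e.wDist · d < δ` of `d` fail `P` too, then `P` is
not tame-Christodoulou-generic in `𝓓`: a tame family through `d` is `wDist`-continuous at `0` on its end
(`IsTameDataFamily`), so some member with non-zero parameter lies in the basin and is exceptional.
Christodoulou, CQG 16 (1999) A23, p. A24 (genericity = exceptional set of positive codimension, tested along
curves in a fixed space of data with fixed asymptotics). [cite: Christodoulou1999, p. A24] -/
theorem not_isTameChristodoulouGeneric_of_wDist_nhds {𝓓 : Set (InitialDataSet (𝓡 3) X)}
    {P : InitialDataSet (𝓡 3) X → Prop} {d : InitialDataSet (𝓡 3) X} (hd : d ∈ 𝓓) (hPd : ¬ P d)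
    (h : ∀ e : AFEnd X, ∃ δ : ℝ≥0∞, 0 < δ ∧ ∀ D' ∈ 𝓓, e.wDist D' d < δ → ¬ P D')
    {m : ℕ} (hm : m ≠ 0) :
    ¬ IsTameChristodoulouGeneric 𝓓 P m := by
  intro hG
  obtain ⟨e, F, hF, -, h0, -, hF𝓓, hgood⟩ := hG d ⟨hd, hPd⟩
  obtain ⟨δ, hδ, hbad⟩ := h e
  -- `e.wDist (F c) (F 0) → 0` as `c → 0`, so it is eventually `< δ`
  have hev : ∀ᶠ c in 𝓝 (0 : EuclideanSpace ℝ (Fin m)), e.wDist (F c) (F 0) < δ :=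
    hF.2.2.2.eventually (gt_mem_nhds hδ)
  -- pick a NON-ZERO parameter in that neighbourhood (`m ≠ 0`, so `0` is not isolated)
  haveI : Nontrivial (EuclideanSpace ℝ (Fin m)) := by
    haveI : Nonempty (Fin m) := ⟨⟨0, Nat.pos_of_ne_zero hm⟩⟩
    infer_instance
  haveI : (𝓝[≠] (0 : EuclideanSpace ℝ (Fin m))).NeBot := Module.punctured_nhds_neBot ℝ _ 0
  have hev' : ∀ᶠ c in 𝓝[≠] (0 : EuclideanSpace ℝ (Fin m)),
      e.wDist (F c) (F 0) < δ ∧ c ∈ ({0}ᶜ : Set (EuclideanSpace ℝ (Fin m))) :=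
    (hev.filter_mono nhdsWithin_le_nhds).and self_mem_nhdsWithin
  obtain ⟨c, hc, hcne⟩ := hev'.exists
  have hcne' : c ≠ 0 := by simpa using hcne
  have hlt : e.wDist (F c) d < δ := by simpa [h0] using hc
  exact hgood c hcne' ⟨hF𝓓 c, hbad (F c) (hF𝓓 c) hlt⟩

/-- **Open-basin kill shape for `T`.**  An admissible datum `d` on some `Σ` which is `P_T`-exceptional
(`d ∉ settlingSetT Σ`) together with, on every end `e` of `Σ`, a positive `δ` such that every admissible datum
with `e.wDist · d < δ` is `P_T`-exceptional, refutes `HonestFixedRadiusSettlingT` (read-back `Negative.T_iff` and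
the general lemma at `m = 1`).  Christodoulou, CQG 16 (1999) A23, p. A24. [cite: Christodoulou1999, p. A24] -/
theorem not_T_of_wDist_nhds (X : Type) [TopologicalSpace X] [ChartedSpace E3 X] [IsManifold (𝓡 3) ∞ X]
    [T2Space X] [SecondCountableTopology X] [ConnectedSpace X]
    {d : InitialDataSet (𝓡 3) X} (hd : d ∈ admissibleVacuumData X) (hbad : d ∉ settlingSetT X)
    (h : ∀ e : AFEnd X, ∃ δ : ℝ≥0∞, 0 < δ ∧
      ∀ D' ∈ admissibleVacuumData X, e.wDist D' d < δ → D' ∉ settlingSetT X) :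
    ¬ HonestFixedRadiusSettlingT :=
  fun hT ↦ not_isTameChristodoulouGeneric_of_wDist_nhds (P := (· ∈ settlingSetT X)) hd hbad h one_ne_zero
    (T_iff.1 hT X)

/-- **The basin alone suffices** (the centre lies in its own basin, `e.wDist d d = 0 < δ`, and an admissible
datum has an end to read the hypothesis on): a `wDist`-open basin of `P_T`-exceptional admissible data around an
admissible datum refutes `T`.  Christodoulou, CQG 16 (1999) A23, p. A24. [cite: Christodoulou1999, p. A24] -/
theorem not_T_of_wDist_basin (X : Type) [TopologicalSpace X] [ChartedSpace E3 X] [IsManifold (𝓡 3) ∞ X]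
    [T2Space X] [SecondCountableTopology X] [ConnectedSpace X]
    {d : InitialDataSet (𝓡 3) X} (hd : d ∈ admissibleVacuumData X)
    (h : ∀ e : AFEnd X, ∃ δ : ℝ≥0∞, 0 < δ ∧
      ∀ D' ∈ admissibleVacuumData X, e.wDist D' d < δ → D' ∉ settlingSetT X) :
    ¬ HonestFixedRadiusSettlingT := by
  obtain ⟨e, -, -⟩ := exists_isSoleEnd_of_mem_admissibleVacuumData hd
  obtain ⟨δ, hδ, hδ'⟩ := h e
  exact not_T_of_wDist_nhds X hd (hδ' d hd (by simpa [AFEnd.wDist_self] using hδ)) h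

/-- **Typed form of liability L2 / BN-4-4 (hidden complete rays, openly).**  Suppose some `Σ` carries an
admissible datum `d` such that, on every end `e`, for some `δ > 0`, EVERY admissible datum `D'` with
`e.wDist D' d < δ` has the following defect: each of its MGHDs `𝒟`, for each candidate `C⁴` decomposition `dd`
of a region `O = exteriorOf 𝒟 dd.charted` (the self-determined exterior), admits a future-complete normalised
null ray from `Σ` leaving `closure O` (`¬ RaysStayInClosure 𝒟 O`) — as a hidden, forever-expanding vacuum region
behind a trapped neck of a one-ended `Σ = M # ℝ³` would produce if it were stable.  Then `HonestFixedRadiusSettlingT`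
is false: every such `D'` is `P_T`-exceptional (if it has an MGHD at all, that MGHD's honest decomposition would
carry the rays clause), and the basin lemma applies.  Dafermos–Luk arXiv:1710.01722, Conjecture 1 (the exterior
region of the conjecture); Christodoulou, CQG 16 (1999) A23, p. A24. [cite: DafermosLuk2017, Conjecture 1]
[cite: Christodoulou1999, p. A24] -/
theorem T_false_of_wDist_nhds_hiddenRays (X : Type) [TopologicalSpace X] [ChartedSpace E3 X]
    [IsManifold (𝓡 3) ∞ X] [T2Space X] [SecondCountableTopology X] [ConnectedSpace X]
    {d : InitialDataSet (𝓡 3) X} (hd : d ∈ admissibleVacuumData X)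
    (h : ∀ e : AFEnd X, ∃ δ : ℝ≥0∞, 0 < δ ∧
      ∀ D' ∈ admissibleVacuumData X, e.wDist D' d < δ →
        ∀ 𝒟 : VacuumCauchyDevelopment D', 𝒟.IsMaximal →
          ∀ (O : Set 𝒟.carrier) (dd : FinalStateDecomposition 𝒟.toSpacetime O 4),
            O = exteriorOf 𝒟.toCauchyDevelopment dd.charted →
              ¬ RaysStayInClosure 𝒟.toCauchyDevelopment O) :
    ¬ HonestFixedRadiusSettlingT := by
  refine not_T_of_wDist_basin X hd fun e ↦ ?_
  obtain ⟨δ, hδ, hδ'⟩ := h e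
  refine ⟨δ, hδ, fun D' hD' hlt hmem ↦ ?_⟩
  obtain ⟨⟨𝒟, h𝒟⟩, hall⟩ := hmem
  obtain ⟨-, O, dd, R₀, hO, hrays, -⟩ := hall 𝒟 h𝒟
  exact hδ' D' hD' hlt 𝒟 h𝒟 O dd hO hrays

/-- **Typed form of a stable naked singularity.**  An admissible datum around which, `wDist`-openly on every
end, every MGHD of every admissible datum has INCOMPLETE future null infinity (sojourn form) refutes
`HonestFixedRadiusSettlingT` — the same basin refutes tame weak cosmic censorship (item 17269), of which `T` is a
strengthening (`Negative.T_false_of_not_wccTame`).  Christodoulou, CQG 16 (1999) A23, pp. A24, A26–A27 (weak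
cosmic censorship as generic completeness of `𝓘⁺`; naked singularities expected unstable).
[cite: Christodoulou1999, pp. A26–A27] -/
theorem T_false_of_wDist_nhds_incompleteScri (X : Type) [TopologicalSpace X] [ChartedSpace E3 X]
    [IsManifold (𝓡 3) ∞ X] [T2Space X] [SecondCountableTopology X] [ConnectedSpace X]
    {d : InitialDataSet (𝓡 3) X} (hd : d ∈ admissibleVacuumData X)
    (h : ∀ e : AFEnd X, ∃ δ : ℝ≥0∞, 0 < δ ∧
      ∀ D' ∈ admissibleVacuumData X, e.wDist D' d < δ →
        ∀ 𝒟 : VacuumCauchyDevelopment D', 𝒟.IsMaximal → ¬ HasCompleteNullInfinity 𝒟.toCauchyDevelopment) :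
    ¬ HonestFixedRadiusSettlingT := by
  refine not_T_of_wDist_basin X hd fun e ↦ ?_
  obtain ⟨δ, hδ, hδ'⟩ := h e
  refine ⟨δ, hδ, fun D' hD' hlt hmem ↦ ?_⟩
  obtain ⟨⟨𝒟, h𝒟⟩, hall⟩ := hmem
  exact hδ' D' hD' hlt 𝒟 h𝒟 (hall 𝒟 h𝒟).1

end Summit.FinalStateConjecture.FinalStateConjecture.Theorems.HonestFixedRadiusSettlingT.Negative.OpenBasin

end
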